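import Summits.CriticalPhenomena.PercolationContinuityZ3.Theses.PercTorusSliceFilling
import Summits.CriticalPhenomena.PercolationContinuityZ3.Theorems.PercTorusSliceFillingTorusNonProliferationStubPacking
import Summits.CriticalPhenomena.PercolationContinuityZ3.Theorems.PercTorusSliceFillingTorusNonProliferationStubSfVolumeMean
import Summits.CriticalPhenomena.PercolationContinuityZ3.Theorems.PercTorusSliceFillingTorusNonProliferationBK
import Summits.CriticalPhenomena.PercolationContinuityZ3.Theorems.PercTorusSliceFillingThinClusterTransportGlue
import Summits.CriticalPhenomena.PercolationContinuityZ3.Theorems.PercTorusSliceFillingTorusNonProliferationAnnulus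

/-!
# Line `birth` — registered skeleton for the crux `TorusNonProliferation`
# (stmt-CriticalPhenomena-5415, route `PercTorusSliceFilling`, rank 4)

Crux (fixed, by name): `PercTorusSliceFilling.TorusNonProliferation` — at `p_c(ℤ³)` the number
`N_sf(T_n)` of SLICE-FILLING open clusters of the discrete torus `T_n = (ℤ/nℤ)³`
(clusters `S = C(x)` with `∃ i, ∀ t : ZMod n, ∃ y ∈ S, y i = t`) is tight:
`∀ δ > 0 ∃ M ∀ n ≥ 3, P_{T_n,p_c}(M ≤ N_sf) ≤ δ`.

THE LINE ("no thin spanning clusters"; the torus-side, rate-free shadow of the route's foreseen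
node `ArmVolumeLowerTail`, i.e. Kesten 1986 Thm (8) / Borgs–Chayes–Kesten–Spencer LOWER tightness of
the volume of spanning-type critical clusters, transplanted from the box of `ℤ²` to the 3-torus).
Write `sf(S)` for slice-filling, `V_sf(ω) := #{x : C(x) sf}` (total sf volume),
`ρ_n := P_{T_n,p_c}(C(0) sf)` and `s_n := n³ ρ_n`. Tightness of the COUNT `N_sf` is split into a
first-moment identity for the total VOLUME, a deterministic packing inequality, and one open
anti-concentration input:

* `stub_sfVolumeMean` (LANDED 2026-08-17, p146104, `Theorems/PercTorusSliceFillingTorusNonProliferation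
  StubSfVolumeMean.lean`; size M; content = transitivity of the torus measure):
  for every `p` and `n ≥ 1`, `E_{T_n,p}[V_sf] = n³ · P_{T_n,p}(C(0) sf)`. Proof route:
  `V_sf = Σ_x 1{C(x) sf}` (finite sum), linearity, and `P(C(x) sf) = P(C(0) sf)` because the
  translation `y ↦ y + x` is an automorphism of `torusGraph 3 n` (`torusGraph_adj_add_right`,
  `FieldCurrentsTransport.torusTranslate`) under which `bondPercolation` is invariant
  (`bondPercolation_map_relabel_iso` / `bondPercolation_real_preimage_relabel_iso`,
  `openGraph_relabel_adj_iff`) and `sf` is covariant (`t ↦ t + x i` permutes `ZMod n`);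
  `Fintype.card (TorusSite 3 n) = n³` (`ZMod.card`).
* `stub_packing` (LANDED 2026-08-17, p145242, `Theorems/PercTorusSliceFillingTorusNonProliferation
  StubPacking.lean`; deterministic, size S): if every sf cluster of `ω` has at least
  `s ≥ 0` vertices then `N_sf(ω) · s ≤ V_sf(ω)` — the sf clusters are pairwise disjoint subsets of
  `{x : C(x) sf}` (`openCluster_eq_iff_mem`; or directly from the landed mass-transport count
  `ncard_clusters_eq_sum`: `N_sf = Σ_x 1{C(x) sf}/|C(x)| ≤ Σ_x 1{C(x) sf}/s = V_sf/s`).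
* `stub_noThinSliceFilling` (OPEN — the content, the hardest stub; the `d = 3` input): at `p_c`,
  slice-filling clusters are (eventually in `n`) not thin at the scale of the mean total sf volume:
  `∀ δ > 0 ∃ η > 0 ∃ N ∀ n ≥ N, P_{T_n,p_c}(∃ x : C(x) sf ∧ |C(x)| ≤ η · s_n) ≤ δ`, `s_n = n³ ρ_n = E V_sf`
  (lead c2 reshape 2026-08-17: the first registration asked this for all `n ≥ 3`; the asymptotic
  form is weaker and is what a limit theorem would deliver — tori with `n < N` carry at most
  `n² < N²` sf clusters, which the composition absorbs into the level `M`)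
  (by stub 1; `ρ_n = P_{ℤ³,p_c}(diam_∞ C(0) ≥ n-1) ≍ π(n/2)` by the card's Lemma A, so `s_n ≍ n^{d_f}`
  under hyperscaling `d_f = 3 - β/ν`, numerically `3 - 0.477 = 2.523`, arXiv:1302.0421).
  Why plausibly true: the `d = 2` analogue is a THEOREM (Kesten 1986 Thm (8): the arm-conditioned
  volume `|C ∩ B(n)|/(n²π_n)` is tight in `(0,∞)`; BCKS 1999/2001: under uniformly bounded crossing
  probabilities every spanning cluster of `Λ_n` has volume `≍ n²π_n` and their number is tight);
  the scaling picture in `d = 3` (non-degenerate continuum limit, clusters of macroscopic diameter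
  carry natural measure `≍ n^{d_f}`) predicts the same. Why it might fail: it is FALSE for `d ≥ 7`
  under `η = 0` (critical torus clusters of extent `n` have volume `≍ n⁴ ≪ η s_n = η n^{d-2}`, so
  thin sf clusters exist w.h.p. — barrier `SpanningClustersAboveSix` applies verbatim: a proof must
  use `d < 6`), and in `d = 3` a fat lower tail of the sf-cluster volume (exponent `κ ≤ 0` in the
  route's `ArmVolumeLowerTail`) or a "shattered" critical torus (many thin spanning clusters) would
  break it; evidence is numerical only (card MC, `n ≤ 32`: `E N_sf ≈ 1.5` flat,
  `E V_sf/n³ = .41…/.20`, slope `-0.51`).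
* `TorusNonProliferation_of : Stubs.stub_sfVolumeMean → Stubs.stub_packing →
  Stubs.stub_noThinSliceFilling → TorusNonProliferation` (the stub `Prop`s BY NAME; conclusion the
  route decl BY NAME), PROVED here with no `sorry` (≈ 120 lines): given `δ`, take `η, N` from stub 3
  at `δ/2` and `M ≥ max(1, 2/(δη)) + N²`; for `3 ≤ n < N` the event `{M ≤ N_sf}` is empty (each sf
  cluster has ≥ n vertices, one per slice, so packing with `s = n` gives `N_sf ≤ n³/n = n² < N² ≤ M`);
  for `n ≥ N` put `L := max(M η s_n, 1)`. If `N_sf ≥ M` and no sf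
  cluster is thin then (packing) `V_sf ≥ N_sf η s_n ≥ M η s_n` and `V_sf ≥ 1`, so
  `{M ≤ N_sf} ⊆ {L ≤ V_sf} ∪ Thin`; Markov (`mul_meas_ge_le_integral_of_nonneg`, `Integrable.of_finite`
  on the finite configuration space) and stub 1 give `L · P(L ≤ V_sf) ≤ E V_sf = s_n ≤ (δ/2) L`
  (trivial if `s_n = 0`, else `M η ≥ 2/δ`), whence `P(M ≤ N_sf) ≤ δ/2 + δ/2`.
* `TorusNonProliferation_proof : TorusNonProliferation := TorusNonProliferation_of stub_sfVolumeMean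
  stub_packing stub_noThinSliceFilling` — the skeleton IS the crux proof once the three sorries go.

* BK BRANCH (added by lead c2, reshaped to its weakest form by lead c4, 2026-08-17):
  `stub_sfWitnessesBounded` (OPEN) — for SOME block length `M₀`, eventually in `n`, with
  probability bounded away from zero the critical torus does NOT carry `M₀` pairwise disjoint
  open witnesses of `E = {some open cluster is sf}`:
  `∃ M₀ ∃ c > 0 ∃ N ∀ n ≥ N, P_{T_n,p_c}((E □^{M₀})ᶜ) ≥ c` (`E □^{M₀} = disjointOccurrencePow E M₀`,
  i.e. `M₀` edge-disjoint open subgraphs each with a slice-filling component). ALONE it implies the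
  crux: `TorusNonProliferation_of_bk`, through the LANDED
  `Theorems/PercTorusSliceFillingTorusNonProliferationBKPow.lean` (p172230:
  `{N_sf ≥ k·M₀} ⊆ (E □^{M₀}) □^k` — group `k·M₀` distinct sf clusters into `k` blocks, the union of
  the open-edge witnesses of a block witnesses `E □^{M₀}` — and the iterated van den Berg–Kesten
  inequality give `P_{T_n,p}(N_sf ≥ k·M₀) ≤ P_{T_n,p}(E □^{M₀})^k ≤ (1 - c)^k`; tori `n < N` carry at
  most `n³ < N³` sf clusters). The case `M₀ = 1`, uniform in `n ≥ 3`, is lead c2's former stub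
  `stub_noSliceFillingPos` ("no sf cluster with probability ≥ c", landed reductions p145605 /
  p146724); the hypotheses weaken as `M₀` grows, and this is the weakest input from which the BK
  mechanism yields tightness, hence the registered form. Status: OPEN in `d = 3` for every `M₀`
  (for `M₀ = 1` it is the torus form of the hard direction of the Borgs–Chayes–Kesten–Spencer
  crossing postulate; immediate from RSW in `d = 2`; FALSE for `d ≥ 7`, where `~n^{d-6}` spanning
  clusters make `E □^{M₀}` almost sure for every fixed `M₀`, Aizenman 1997 Thm 4 — barrier
  `SpanningClustersAboveSix`). Numerically (lead c3 MC, n ≤ 128): `P(N_sf = 0) ≈ .005` but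
  `P(N_sf ≤ 1) ≈ .56`, `P(N_sf ≤ 2) ≈ .9` — the block form is the robust target.

* X_B BRANCH (added by lead c3, 2026-08-17): the BK stub is implied by the EXISTING crux
  `PercAnnulusCrossing.CritAnnulusNonCrossing` (X_B, item stmt-CriticalPhenomena-0846: at `p_c`,
  `P(B(m) ↔ ∂ⁱⁿB(2m) in B(2m)) ≤ 1 - c` uniformly in `m`): LANDED
  `Theorems/PercTorusSliceFillingTorusNonProliferationAnnulus.lean` (p160739) proves
  `noSliceFilling_eventually_pos_of_critAnnulusNonCrossing` (27 projected boxes of radius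
  `m = ⌊(n-2)/4⌋` cover `T_n`; a sf cluster through one of them forces the annulus crossing in the
  chart of `B(2m)`; iterated Harris–FKG gives `P_{T_n,p_c}(no sf) ≥ c^27` for `n ≥ 6`) and
  `torusNonProliferation_of_critAnnulusNonCrossing : CritAnnulusNonCrossing → TorusNonProliferation`
  (third closing `TorusNonProliferation_of_xb` below, sorry-free modulo item 0846). Conversely the
  BK stub (asymptotic form) implies `PercAnnulusCrossing.CubeBlockingSeed` (item
  stmt-CriticalPhenomena-1141; `Theorems/PercTorusSliceFillingTorusNonProliferationCubeSeed.lean`: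
  wrap the cube `[0,n]³` once around `T_{n+1}`), so `stub_noSliceFillingPos` sits between the two
  open cruxes 0846 ⟹ BK stub (M₀ = 1) ⟹ 1141 of route `PercAnnulusCrossing` — it is crux-sized, and since
  X_B already implies `θ(p_c) = 0` (assembly of `PercAnnulusCrossing`, landed) the BK branch cannot
  shorten this route. Sufficient inputs for the crux now on record: `ThinClusterRarity` (item 5414,
  `ThinClusterTransport`), X_B (item 0846, this branch), stub 3 of line `birth`.

Why this cut and not the route's own edge: the in-route reduction `ThinClusterRarity →
TorusNonProliferation` (`ThinClusterTransport`, LANDED) goes through a BOUNDED MEAN `E N_sf ≤ 512 C`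
fed by the `ℤ³` box harmonic moment `E[1{A_m}/|C^{B(m)}(0)|] ≤ C/m³` (crux `ThinClusterRarity`,
rank 3, itself an item — restating it here would be costume). Tightness is weaker than a bounded
mean, and the present line isolates exactly the part of hyperscaling that TIGHTNESS needs: the
total sf volume is controlled for free (stub 1 is an identity, Markov loses nothing in the
exponent), so the only `d = 3` input is the LOWER-TAIL statement of stub 3 (no rate, no harmonic
moment); neither `ThinClusterRarity ⇒ stub 3` nor the converse is formal (TCR bounds
`n³ E[1{sf} 1{|C| ≤ η s_n}/|C|]` by a constant, not by `o_η(1)`; stub 3 gives tightness, not a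
bounded mean), while the route's foreseen `ArmVolumeLowerTail` (`κ > 0`) implies both.

Disproof.lean: none filed for this crux (`ledger crux ls stmt-CriticalPhenomena-5415`: no
workfiles, 2026-08-17); no `_false_without_` theorem, no landed `Theorems/TorusNonProliferation/
Negative/*`; negatives index of the summit: no statement about torus cluster counts or volumes.
Degenerate cases honoured: `n ≥ 1` in stubs 1–2 (for `n = 0`, `TorusSite 3 0 = ℤ³` and `ncard` of
infinite sets is junk `0`), `n ≥ 3` in stub 3 as in the crux; `s_n = 0` is harmless (then
`V_sf = 0` a.s. and the thin event is empty) and is handled in the composition by the level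
`L = max(M η s_n, 1)`. No new route, no restatement of the crux.
-/

noncomputable section

open MeasureTheory Filter Set
open Literature.Probability.Percolation Literature.Probability.LatticeModels

namespace Summit.CriticalPhenomena.PercolationContinuityZ3.Cruxes.TorusNonProliferation.Birth

/-! ## The three registered stubs: precise `Prop`s `Stubs.stub_*` + sorried theorems `stub_*` -/

namespace Stubs

/-- **Stub `Prop` 1 (`SfVolumeMean`, provable now)** — first moment of the total slice-filling
volume on the torus, by transitivity: `E_{T_n,p}[#{x : C(x) sf}] = n³ · P_{T_n,p}(C(0) sf)` for
every `p` and `n ≥ 1`. -/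
def stub_sfVolumeMean : Prop :=
  ∀ (p : unitInterval) (n : ℕ), 1 ≤ n →
    ∫ ω, (Set.ncard {x : TorusSite 3 n |
        ∃ i : Fin 3, ∀ t : ZMod n, ∃ y ∈ openCluster ω x, y i = t} : ℝ)
      ∂(bondPercolation (torusGraph 3 n) p) =
    (n : ℝ) ^ 3 * (bondPercolation (torusGraph 3 n) p).real
      {ω | ∃ i : Fin 3, ∀ t : ZMod n, ∃ y ∈ openCluster ω (0 : TorusSite 3 n), y i = t}

/-- **Stub `Prop` 2 (`Packing`, provable now, deterministic)** — if every slice-filling cluster of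
`ω` has at least `s ≥ 0` vertices, then `N_sf(ω) · s ≤ V_sf(ω) = #{x : C(x) sf}` (`n ≥ 1`). -/
def stub_packing : Prop :=
  ∀ (n : ℕ), 1 ≤ n → ∀ (ω : BondConfig (TorusSite 3 n)) (s : ℝ), 0 ≤ s →
    (∀ x : TorusSite 3 n, (∃ i : Fin 3, ∀ t : ZMod n, ∃ y ∈ openCluster ω x, y i = t) →
      s ≤ ((openCluster ω x).ncard : ℝ)) →
    (Set.ncard {S : Set (TorusSite 3 n) | (∃ x, S = openCluster ω x) ∧
        ∃ i : Fin 3, ∀ t : ZMod n, ∃ y ∈ S, y i = t} : ℝ) * s ≤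
      (Set.ncard {x : TorusSite 3 n |
        ∃ i : Fin 3, ∀ t : ZMod n, ∃ y ∈ openCluster ω x, y i = t} : ℝ)

/-- **Stub `Prop` 3 (`NoThinSliceFilling`, OPEN, the hardest stub; ASYMPTOTIC form, reshaped by
lead c2)** — at `p_c(ℤ³)`, slice-filling clusters of the 3-torus are eventually not thin at the
scale `s_n = n³ · P(C(0) sf)` of the mean total slice-filling volume: `∀ δ > 0 ∃ η > 0 ∃ N ∀ n ≥ N,
P_{T_n,p_c}(∃ x, C(x) sf ∧ |C(x)| ≤ η s_n) ≤ δ`. (Weaker than the `∀ n ≥ 3` form first registered: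
small tori are absorbed by the composition, since `N_sf ≤ n²`.) -/
def stub_noThinSliceFilling : Prop :=
  ∀ δ : ℝ, 0 < δ → ∃ η : ℝ, 0 < η ∧ ∃ N : ℕ, ∀ n : ℕ, N ≤ n →
    (bondPercolation (torusGraph 3 n) (criticalProbI 3)).real
      {ω | ∃ x : TorusSite 3 n,
        (∃ i : Fin 3, ∀ t : ZMod n, ∃ y ∈ openCluster ω x, y i = t) ∧
        ((openCluster ω x).ncard : ℝ) ≤ η * ((n : ℝ) ^ 3 *
          (bondPercolation (torusGraph 3 n) (criticalProbI 3)).real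
            {ω' | ∃ i : Fin 3, ∀ t : ZMod n,
              ∃ y ∈ openCluster ω' (0 : TorusSite 3 n), y i = t})} ≤ δ

/-- **Stub `Prop` 4 (`SfWitnessesBounded`, OPEN; the BK branch in its weakest form — lead c2's
`NoSliceFillingPos` is the case `M₀ = 1`, reshaped by lead c4)** — for some block length `M₀`,
eventually in `n`, the critical 3-torus carries `M₀` pairwise disjoint open witnesses of
`E = {some open cluster is slice-filling}` only with probability bounded away from one:
`∃ M₀ ∃ c > 0 ∃ N ∀ n ≥ N, P_{T_n,p_c}((disjointOccurrencePow E M₀)ᶜ) ≥ c`. Alone it implies the crux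
(`TorusNonProliferation_of_bk`, via the LANDED block BK reduction
`Theorems.torusNonProliferation_of_sfWitnesses_eventually_bounded`:
`P(N_sf ≥ k·M₀) ≤ P(E □^{M₀})^k ≤ (1-c)^k`). For `M₀ = 1` it is the torus/slice-filling form of the
hard direction of the Borgs–Chayes–Kesten–Spencer crossing postulate ("critical crossing
probabilities stay bounded away from one"): immediate from RSW in `d = 2`, FALSE for `d ≥ 7` for
every `M₀` (Aizenman 1997 Thm 4), open in `d = 3`. -/
def stub_sfWitnessesBounded : Prop :=
  ∃ M₀ : ℕ, ∃ c : ℝ, 0 < c ∧ ∃ N : ℕ, ∀ n : ℕ, N ≤ n →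
    c ≤ (bondPercolation (torusGraph 3 n) (criticalProbI 3)).real
      (disjointOccurrencePow {ω : BondConfig (TorusSite 3 n) |
        ∃ x : TorusSite 3 n, ∃ i : Fin 3, ∀ t : ZMod n, ∃ y ∈ openCluster ω x, y i = t} M₀)ᶜ

end Stubs

/-- **stub 1 (registered) = `Stubs.stub_sfVolumeMean` spelled out** — for every `p` and every
`n ≥ 1`, `E_{T_n,p}[V_sf] = n³ · P_{T_n,p}(C(0) sf)` where `V_sf = #{x : C(x) slice-filling}`.
Transitivity of `bondPercolation (torusGraph 3 n) p` under the translations `y ↦ y + x`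
(`torusGraph_adj_add_right` + `bondPercolation_real_preimage_relabel_iso`), covariance of
slice-filling under translation, `V_sf = Σ_x 1{C(x) sf}`, `card (TorusSite 3 n) = n³`.
PROVABLE NOW; size M. -/
theorem stub_sfVolumeMean :
    ∀ (p : unitInterval) (n : ℕ), 1 ≤ n →
      ∫ ω, (Set.ncard {x : TorusSite 3 n |
          ∃ i : Fin 3, ∀ t : ZMod n, ∃ y ∈ openCluster ω x, y i = t} : ℝ)
        ∂(bondPercolation (torusGraph 3 n) p) =
      (n : ℝ) ^ 3 * (bondPercolation (torusGraph 3 n) p).real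
        {ω | ∃ i : Fin 3, ∀ t : ZMod n, ∃ y ∈ openCluster ω (0 : TorusSite 3 n), y i = t} :=
  -- LANDED (p146104): Theorems/PercTorusSliceFillingTorusNonProliferationStubSfVolumeMean.lean
  Summit.CriticalPhenomena.PercolationContinuityZ3.Theorems.PercTorusSliceFillingTorusNonProliferation.stub_sfVolumeMean

/-- **stub 2 (registered) = `Stubs.stub_packing` spelled out** — deterministic packing: on `T_n`,
`n ≥ 1`, if every slice-filling cluster has `≥ s` vertices (`s ≥ 0` real) then
`N_sf · s ≤ V_sf`. The sf clusters are pairwise disjoint nonempty subsets of `{x : C(x) sf}`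
(`openCluster_eq_iff_mem`); equivalently `N_sf = Σ_x 1{C(x) sf}/|C(x)|` (landed
`ncard_clusters_eq_sum`) `≤ V_sf / s`. PROVABLE NOW; size S–M. -/
theorem stub_packing :
    ∀ (n : ℕ), 1 ≤ n → ∀ (ω : BondConfig (TorusSite 3 n)) (s : ℝ), 0 ≤ s →
      (∀ x : TorusSite 3 n, (∃ i : Fin 3, ∀ t : ZMod n, ∃ y ∈ openCluster ω x, y i = t) →
        s ≤ ((openCluster ω x).ncard : ℝ)) →
      (Set.ncard {S : Set (TorusSite 3 n) | (∃ x, S = openCluster ω x) ∧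
          ∃ i : Fin 3, ∀ t : ZMod n, ∃ y ∈ S, y i = t} : ℝ) * s ≤
        (Set.ncard {x : TorusSite 3 n |
          ∃ i : Fin 3, ∀ t : ZMod n, ∃ y ∈ openCluster ω x, y i = t} : ℝ) :=
  -- LANDED (p145242): Theorems/PercTorusSliceFillingTorusNonProliferationStubPacking.lean
  Summit.CriticalPhenomena.PercolationContinuityZ3.Theorems.PercTorusSliceFillingTorusNonProliferation.stub_packing

/-- **stub 3 (registered) = `Stubs.stub_noThinSliceFilling` spelled out (OPEN; the hardest
stub; asymptotic form)** — no thin slice-filling clusters on large critical 3-tori: for every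
`δ > 0` there are `η > 0` and `N` such that for all `n ≥ N`, with `s_n := n³ · P_{T_n,p_c}(C(0) sf)`
(`= E V_sf` by stub 1, `≍ n^{d_f}` under hyperscaling), the probability that some slice-filling
cluster has at most `η s_n` vertices is `≤ δ`. The `d = 2` analogue is Kesten 1986 Thm (8) / BCKS 2001 (lower
tightness of spanning-cluster volume at scale `n²π_n`); FALSE for `d ≥ 7` under `η = 0`
(`SpanningClustersAboveSix`: extent-`n` critical torus clusters have volume `n⁴ ≪ η n^{d-2}`), so a
proof must use `d < 6`; `d = 3` evidence numerical only (arXiv:1302.0421, card MC). Size: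
open-problem (hyperscaling-class, lower tail only, no rate). -/
theorem stub_noThinSliceFilling :
    ∀ δ : ℝ, 0 < δ → ∃ η : ℝ, 0 < η ∧ ∃ N : ℕ, ∀ n : ℕ, N ≤ n →
      (bondPercolation (torusGraph 3 n) (criticalProbI 3)).real
        {ω | ∃ x : TorusSite 3 n,
          (∃ i : Fin 3, ∀ t : ZMod n, ∃ y ∈ openCluster ω x, y i = t) ∧
          ((openCluster ω x).ncard : ℝ) ≤ η * ((n : ℝ) ^ 3 *
            (bondPercolation (torusGraph 3 n) (criticalProbI 3)).real
              {ω' | ∃ i : Fin 3, ∀ t : ZMod n,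
                ∃ y ∈ openCluster ω' (0 : TorusSite 3 n), y i = t})} ≤ δ := by
  sorry

/-- **stub 4 (registered; lead c4's reshape of lead c2's BK stub) = `Stubs.stub_sfWitnessesBounded`
spelled out (OPEN; the BK branch in its weakest form)** — `∃ M₀ ∃ c > 0 ∃ N ∀ n ≥ N,
P_{T_n,p_c}(not M₀ pairwise disjoint open witnesses of "some cluster is slice-filling") ≥ c`. With
the landed block BK reduction this closes the crux (`TorusNonProliferation_proof_bk`),
independently of stubs 1–3. Open in `d = 3` (BCKS hard direction for `M₀ = 1`, weaker for larger
`M₀`); false for `d ≥ 7`. -/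
theorem stub_sfWitnessesBounded :
    ∃ M₀ : ℕ, ∃ c : ℝ, 0 < c ∧ ∃ N : ℕ, ∀ n : ℕ, N ≤ n →
      c ≤ (bondPercolation (torusGraph 3 n) (criticalProbI 3)).real
        (disjointOccurrencePow {ω : BondConfig (TorusSite 3 n) |
          ∃ x : TorusSite 3 n, ∃ i : Fin 3, ∀ t : ZMod n, ∃ y ∈ openCluster ω x, y i = t} M₀)ᶜ := by
  sorry

/-! ## The composition (proved): the three stubs imply the crux BY NAME -/

/-- **`TorusNonProliferation` from the three stubs** (hypotheses = the declared stub `Prop`s by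
name; conclusion = the route decl `PercTorusSliceFilling.TorusNonProliferation` by name; no
`sorry`). First moment of the total slice-filling volume (stub 1 + Markov on the finite
configuration space) + packing (stub 2) + no thin slice-filling clusters (stub 3). -/
theorem TorusNonProliferation_of (h1 : Stubs.stub_sfVolumeMean) (h2 : Stubs.stub_packing)
    (h3 : Stubs.stub_noThinSliceFilling) :
    Summit.CriticalPhenomena.PercolationContinuityZ3.Theses.PercTorusSliceFilling.TorusNonProliferation := by
  classical
  unfold Stubs.stub_sfVolumeMean at h1
  unfold Stubs.stub_packing at h2
  unfold Stubs.stub_noThinSliceFilling at h3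
  intro δ hδ
  -- stub 3 at tolerance δ/2, valid from the threshold `N₀` on
  obtain ⟨η, hη, N₀, hthin⟩ := h3 (δ / 2) (half_pos hδ)
  -- the level `M ≥ max (1, 2/(δ η)) + N₀²`
  obtain ⟨M, hM⟩ := exists_nat_ge (max 1 (2 / (δ * η)) + (N₀ : ℝ) ^ 2)
  have hN0sq : (0 : ℝ) ≤ (N₀ : ℝ) ^ 2 := by positivity
  have hM1 : (1 : ℝ) ≤ M := by
    have := le_max_left (1 : ℝ) (2 / (δ * η)); linarith
  have hM2 : 2 / (δ * η) ≤ M := by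
    have := le_max_right (1 : ℝ) (2 / (δ * η)); linarith
  have hM3 : (N₀ : ℝ) ^ 2 ≤ M := by
    have : (0 : ℝ) ≤ max 1 (2 / (δ * η)) := le_trans zero_le_one (le_max_left _ _)
    linarith
  have hM1' : 1 ≤ M := by exact_mod_cast hM1
  have hM3' : N₀ ^ 2 ≤ M := by exact_mod_cast hM3
  refine ⟨M, fun n hn => ?_⟩
  haveI : NeZero n := ⟨by omega⟩
  -- small tori `3 ≤ n < N₀`: there are at most `n² < N₀² ≤ M` slice-filling clusters, the event is empty
  by_cases hnN : ¬ N₀ ≤ n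
  · have hlt : n < N₀ := Nat.lt_of_not_le hnN
    -- every slice-filling cluster has at least `n` vertices (one in each slice)
    have hbig_n : ∀ (ω : BondConfig (TorusSite 3 n)) (x : TorusSite 3 n),
        (∃ i : Fin 3, ∀ t : ZMod n, ∃ y ∈ openCluster ω x, y i = t) →
          (n : ℝ) ≤ ((openCluster ω x).ncard : ℝ) := by
      rintro ω x ⟨i, hi⟩
      choose f hf using hi
      have hinj : Function.Injective f := fun t t' h => by rw [← (hf t).2, ← (hf t').2, h]
      have hsub : Set.range f ⊆ openCluster ω x := by
        rintro _ ⟨t, rfl⟩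
        exact (hf t).1
      have h1 : (Set.range f).ncard = n := by
        rw [Set.ncard_range_of_injective hinj, Nat.card_eq_fintype_card, ZMod.card]
      have h2 : (Set.range f).ncard ≤ (openCluster ω x).ncard :=
        Set.ncard_le_ncard hsub (Set.toFinite _)
      exact_mod_cast h1 ▸ h2
    have hcard : Nat.card (TorusSite 3 n) = n ^ 3 := by
      rw [Nat.card_eq_fintype_card, Fintype.card_pi, Finset.prod_const, ZMod.card, Finset.card_univ,
        Fintype.card_fin]
    have hsub0 : {ω : BondConfig (TorusSite 3 n) | M ≤ Set.ncard {S : Set (TorusSite 3 n) |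
        (∃ x, S = openCluster ω x) ∧ ∃ i : Fin 3, ∀ t : ZMod n, ∃ y ∈ S, y i = t}} ⊆ ∅ := by
      intro ω hω
      have hω' : M ≤ Set.ncard {S : Set (TorusSite 3 n) |
          (∃ x, S = openCluster ω x) ∧ ∃ i : Fin 3, ∀ t : ZMod n, ∃ y ∈ S, y i = t} := hω
      have hpack := h2 n (by omega) ω (n : ℝ) (Nat.cast_nonneg n) (hbig_n ω)
      have hV : (Set.ncard {x : TorusSite 3 n |
          ∃ i : Fin 3, ∀ t : ZMod n, ∃ y ∈ openCluster ω x, y i = t} : ℝ) ≤ (n : ℝ) ^ 3 := by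
        have := Set.ncard_le_card {x : TorusSite 3 n |
          ∃ i : Fin 3, ∀ t : ZMod n, ∃ y ∈ openCluster ω x, y i = t}
        rw [hcard] at this
        exact_mod_cast this
      have hn0 : (0 : ℝ) < n := by exact_mod_cast (show 0 < n by omega)
      have hNle : (Set.ncard {S : Set (TorusSite 3 n) |
          (∃ x, S = openCluster ω x) ∧ ∃ i : Fin 3, ∀ t : ZMod n, ∃ y ∈ S, y i = t} : ℝ) ≤
            (n : ℝ) ^ 2 := by
        have h' := hpack.trans hV
        have h'' : (n : ℝ) ^ 3 = (n : ℝ) ^ 2 * n := by ring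
        rw [h''] at h'
        exact le_of_mul_le_mul_right h' hn0
      have hNle' : Set.ncard {S : Set (TorusSite 3 n) |
          (∃ x, S = openCluster ω x) ∧ ∃ i : Fin 3, ∀ t : ZMod n, ∃ y ∈ S, y i = t} ≤ n ^ 2 := by
        exact_mod_cast hNle
      have hnsq : n ^ 2 < N₀ ^ 2 := Nat.pow_lt_pow_left hlt two_ne_zero
      exact absurd (hω'.trans hNle') (by omega)
    calc (bondPercolation (torusGraph 3 n) (criticalProbI 3)).real
          {ω : BondConfig (TorusSite 3 n) | M ≤ Set.ncard {S : Set (TorusSite 3 n) |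
            (∃ x, S = openCluster ω x) ∧ ∃ i : Fin 3, ∀ t : ZMod n, ∃ y ∈ S, y i = t}}
        ≤ (bondPercolation (torusGraph 3 n) (criticalProbI 3)).real (∅ : Set _) :=
          measureReal_mono hsub0
      _ = 0 := measureReal_empty
      _ ≤ δ := hδ.le
  push Not at hnN
  -- abbreviations
  set μ := bondPercolation (torusGraph 3 n) (criticalProbI 3) with hμ
  set N : BondConfig (TorusSite 3 n) → ℕ := fun ω => Set.ncard {S : Set (TorusSite 3 n) |
      (∃ x, S = openCluster ω x) ∧ ∃ i : Fin 3, ∀ t : ZMod n, ∃ y ∈ S, y i = t} with hN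
  set V : BondConfig (TorusSite 3 n) → ℕ := fun ω => Set.ncard {x : TorusSite 3 n |
      ∃ i : Fin 3, ∀ t : ZMod n, ∃ y ∈ openCluster ω x, y i = t} with hV
  set ρ : ℝ := μ.real {ω | ∃ i : Fin 3, ∀ t : ZMod n,
      ∃ y ∈ openCluster ω (0 : TorusSite 3 n), y i = t} with hρ
  set s : ℝ := (n : ℝ) ^ 3 * ρ with hs
  set Thin : Set (BondConfig (TorusSite 3 n)) := {ω | ∃ x : TorusSite 3 n,
      (∃ i : Fin 3, ∀ t : ZMod n, ∃ y ∈ openCluster ω x, y i = t) ∧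
        ((openCluster ω x).ncard : ℝ) ≤ η * s} with hThin
  set L : ℝ := max ((M : ℝ) * (η * s)) 1 with hL
  set Thick : Set (BondConfig (TorusSite 3 n)) := {ω | L ≤ (V ω : ℝ)} with hThick
  show μ.real {ω | M ≤ N ω} ≤ δ
  have hthin' : μ.real Thin ≤ δ / 2 := hthin n hnN
  -- signs
  have hρ0 : 0 ≤ ρ := measureReal_nonneg
  have hs0 : 0 ≤ s := mul_nonneg (pow_nonneg (Nat.cast_nonneg _) 3) hρ0
  have hηs0 : 0 ≤ η * s := mul_nonneg hη.le hs0
  have hL1 : (1 : ℝ) ≤ L := le_max_right _ _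
  have hL0 : (0 : ℝ) < L := lt_of_lt_of_le one_pos hL1
  -- (i) the event inclusion `{M ≤ N_sf} ⊆ Thick ∪ Thin`
  have hincl : {ω | M ≤ N ω} ⊆ Thick ∪ Thin := by
    intro ω hω
    have hω' : M ≤ N ω := hω
    by_cases hT : ω ∈ Thin
    · exact Or.inr hT
    · left
      -- no thin cluster: every sf cluster has at least `η s` vertices
      have hbig : ∀ x : TorusSite 3 n,
          (∃ i : Fin 3, ∀ t : ZMod n, ∃ y ∈ openCluster ω x, y i = t) →
            η * s ≤ ((openCluster ω x).ncard : ℝ) := by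
        intro x hx
        by_contra hlt
        push Not at hlt
        exact hT ⟨x, hx, hlt.le⟩
      have hpack : (N ω : ℝ) * (η * s) ≤ (V ω : ℝ) := h2 n (by omega) ω (η * s) hηs0 hbig
      -- some sf cluster exists, so `V ω ≥ 1`
      have hN0 : Set.ncard {S : Set (TorusSite 3 n) | (∃ x, S = openCluster ω x) ∧
          ∃ i : Fin 3, ∀ t : ZMod n, ∃ y ∈ S, y i = t} ≠ 0 := by
        change N ω ≠ 0
        omega
      obtain ⟨S, hS⟩ := Set.nonempty_of_ncard_ne_zero hN0
      obtain ⟨⟨x, rfl⟩, hxsf⟩ := hS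
      have hVpos : 0 < V ω := by
        change 0 < Set.ncard {x : TorusSite 3 n |
          ∃ i : Fin 3, ∀ t : ZMod n, ∃ y ∈ openCluster ω x, y i = t}
        exact (Set.ncard_pos (Set.toFinite _)).2 ⟨x, hxsf⟩
      have hV1 : (1 : ℝ) ≤ (V ω : ℝ) := by exact_mod_cast hVpos
      have hMle : (M : ℝ) * (η * s) ≤ (V ω : ℝ) := by
        have hMN : (M : ℝ) ≤ (N ω : ℝ) := by exact_mod_cast hω'
        exact (mul_le_mul_of_nonneg_right hMN hηs0).trans hpack
      show L ≤ (V ω : ℝ)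
      exact max_le hMle hV1
  -- (ii) Markov for `V_sf` at level `L`, with `E V_sf = s` by stub 1
  have hint : Integrable (fun ω => (V ω : ℝ)) μ := Integrable.of_finite
  have hnonneg : 0 ≤ᵐ[μ] (fun ω => (V ω : ℝ)) :=
    Eventually.of_forall fun ω => Nat.cast_nonneg _
  have hmarkov : L * μ.real Thick ≤ ∫ ω, (V ω : ℝ) ∂μ :=
    mul_meas_ge_le_integral_of_nonneg hnonneg hint L
  have hmean : ∫ ω, (V ω : ℝ) ∂μ = s := h1 (criticalProbI 3) n (by omega)
  have hthick : μ.real Thick ≤ δ / 2 := by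
    have hkey : L * μ.real Thick ≤ s := hmarkov.trans_eq hmean
    have hsL : s ≤ (δ / 2) * L := by
      rcases hs0.eq_or_lt with hs00 | hspos
      · rw [← hs00]
        exact mul_nonneg (half_pos hδ).le hL0.le
      · have hML : (M : ℝ) * (η * s) ≤ L := le_max_left _ _
        have h2le : 2 / (δ * η) * (η * s) ≤ (M : ℝ) * (η * s) :=
          mul_le_mul_of_nonneg_right hM2 hηs0
        have hη0 : η ≠ 0 := hη.ne'
        have hδ0 : δ ≠ 0 := hδ.ne'
        have hcalc : 2 / (δ * η) * (η * s) = 2 / δ * s := by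
          calc 2 / (δ * η) * (η * s) = 2 / δ * (η⁻¹ * η) * s := by ring
            _ = 2 / δ * s := by rw [inv_mul_cancel₀ hη0, mul_one]
        have h3 : 2 / δ * s ≤ L := by
          rw [← hcalc]
          exact h2le.trans hML
        calc s = (δ / 2) * (2 / δ * s) := by
              rw [← mul_assoc, div_mul_div_comm, mul_comm δ 2, div_self (by positivity), one_mul]
          _ ≤ (δ / 2) * L := mul_le_mul_of_nonneg_left h3 (half_pos hδ).le
    have h' : L * μ.real Thick ≤ L * (δ / 2) := by
      calc L * μ.real Thick ≤ s := hkey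
        _ ≤ (δ / 2) * L := hsL
        _ = L * (δ / 2) := mul_comm _ _
    exact le_of_mul_le_mul_left h' hL0
  -- (iii) conclude
  calc μ.real {ω | M ≤ N ω} ≤ μ.real (Thick ∪ Thin) := measureReal_mono hincl
    _ ≤ μ.real Thick + μ.real Thin := measureReal_union_le _ _
    _ ≤ δ / 2 + δ / 2 := add_le_add hthick hthin'
    _ = δ := add_halves δ

/-- **The skeleton IS the crux proof** (D-0027 §3.3): `TorusNonProliferation` from the three
registered stubs; sorry-free as soon as `stub_sfVolumeMean`, `stub_packing`,
`stub_noThinSliceFilling` are discharged. -/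
theorem TorusNonProliferation_proof :
    Summit.CriticalPhenomena.PercolationContinuityZ3.Theses.PercTorusSliceFilling.TorusNonProliferation :=
  TorusNonProliferation_of stub_sfVolumeMean stub_packing stub_noThinSliceFilling

/-! ## Block BK reduction (lead c4) — INLINE COPY of the LANDED file
`Theorems/PercTorusSliceFillingTorusNonProliferationBKPow.lean` (p172230, commit a32aa99c97c9).
TEMPORARY: the farm had not yet built that module when this reshape was registered (lean check
rc 75 `unbuilt` for > 1 h); once it is built, replace this section by
`import Summits.CriticalPhenomena.PercolationContinuityZ3.Theorems.PercTorusSliceFillingTorusNonProliferationBKPow`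
and point `TorusNonProliferation_of_bk` at
`Summit.CriticalPhenomena.PercolationContinuityZ3.Theorems.torusNonProliferation_of_sfWitnesses_eventually_bounded`.
The declarations below live in THIS file's namespace (no clash with the landed FQNs). -/

namespace BlockBK

open Summit.CriticalPhenomena.PercolationContinuityZ3.Theorems
open Summit.CriticalPhenomena.PercolationContinuityZ3.Theorems.PercTorusSliceFillingTorusNonProliferationBK
open scoped Literature.Probability.Percolation

/-- **`{N_sf ≥ k·M₀} ⊆ (E □^{M₀}) □^k`** for `E = {some open cluster is slice-filling}`: `k·M₀`
distinct slice-filling clusters, grouped into `k` blocks of `M₀`, carry `k` pairwise disjoint open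
witnesses of `E □^{M₀}` (each block witness is the union of the open-edge witnesses
`{e ∈ ω | both endpoints in C(x_j)}` of its `M₀` clusters). [folklore] -/
theorem setOf_mul_le_numSliceFilling_subset (n : ℕ) [NeZero n] (M₀ k : ℕ) :
    {ω : BondConfig (TorusSite 3 n) | k * M₀ ≤ Set.ncard {S : Set (TorusSite 3 n) |
        (∃ x, S = openCluster ω x) ∧ ∃ i : Fin 3, ∀ t : ZMod n, ∃ y ∈ S, y i = t}} ⊆
      disjointOccurrencePow (disjointOccurrencePow
        {ω : BondConfig (TorusSite 3 n) | ∃ x : TorusSite 3 n, ∃ i : Fin 3, ∀ t : ZMod n,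
          ∃ y ∈ openCluster ω x, y i = t} M₀) k := by
  classical
  intro ω hω
  rw [Set.mem_setOf_eq] at hω
  set 𝒮 : Set (Set (TorusSite 3 n)) := {S : Set (TorusSite 3 n) |
      (∃ x, S = openCluster ω x) ∧ ∃ i : Fin 3, ∀ t : ZMod n, ∃ y ∈ S, y i = t} with h𝒮
  have hfin : 𝒮.Finite := Set.toFinite 𝒮
  letI : Fintype ↥𝒮 := hfin.fintype
  have hcard : k * M₀ ≤ Fintype.card ↥𝒮 := by
    rwa [← Nat.card_eq_fintype_card, Nat.card_coe_set_eq]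
  -- `k·M₀` distinct slice-filling clusters, indexed by pairs `(block, position)`
  let ι : Fin k × Fin M₀ ↪ ↥𝒮 :=
    (finProdFinEquiv.toEmbedding.trans (Fin.castLEEmb hcard)).trans
      (Fintype.equivFin _).symm.toEmbedding
  have hrep : ∀ j : Fin k × Fin M₀, ∃ x : TorusSite 3 n,
      ((ι j : Set (TorusSite 3 n)) = openCluster ω x) := fun j => (ι j).2.1
  choose x hx using hrep
  have hsf : ∀ j : Fin k × Fin M₀, ∃ i : Fin 3, ∀ t : ZMod n, ∃ y ∈ openCluster ω (x j), y i = t :=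
    fun j => by rw [← hx j]; exact (ι j).2.2
  have hne : ∀ j j' : Fin k × Fin M₀, j ≠ j' → openCluster ω (x j) ≠ openCluster ω (x j') := by
    intro j j' hjj' heq
    exact hjj' (ι.injective (Subtype.ext (by rw [hx j, hx j', heq])))
  -- the open-edge witness of the cluster of `x j`
  set W : Fin k × Fin M₀ → BondConfig (TorusSite 3 n) :=
    fun j => {e | e ∈ ω ∧ ∀ v ∈ e, (openGraph ω).Reachable (x j) v} with hW
  have hWE : ∀ j, W j ∈ {ω : BondConfig (TorusSite 3 n) | ∃ x : TorusSite 3 n, ∃ i : Fin 3,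
      ∀ t : ZMod n, ∃ y ∈ openCluster ω x, y i = t} := by
    intro j
    obtain ⟨i, hi⟩ := hsf j
    refine ⟨x j, i, fun t => ?_⟩
    obtain ⟨y, hy, hyt⟩ := hi t
    exact ⟨y, openCluster_subset_openCluster_clusterEdges ω (x j) hy, hyt⟩
  have hWdisj : ∀ j j', j ≠ j' → Disjoint (W j) (W j') :=
    fun j j' hjj' => disjoint_clusterEdges (hne j j' hjj')
  have hE : IsUpperSet {ω : BondConfig (TorusSite 3 n) | ∃ x : TorusSite 3 n, ∃ i : Fin 3,
      ∀ t : ZMod n, ∃ y ∈ openCluster ω x, y i = t} := isUpperSet_sfEvent n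
  -- block witnesses
  refine mem_disjointOccurrencePow_of_pairwise_disjoint (hE.disjointOccurrencePow M₀)
    (fun g => ⋃ m : Fin M₀, W (g, m))
    (fun g => Set.iUnion_subset fun m => clusterEdges_subset ω (x (g, m)))
    (fun g => ?_) (fun g g' hgg' => ?_)
  · -- each block witness lies in `E □^{M₀}`
    exact mem_disjointOccurrencePow_of_pairwise_disjoint hE (fun m => W (g, m))
      (fun m => Set.subset_iUnion (fun m : Fin M₀ => W (g, m)) m) (fun m => hWE (g, m))
      fun m m' hmm' => hWdisj (g, m) (g, m') fun h => hmm' (Prod.ext_iff.1 h).2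
  · -- different blocks give disjoint witnesses
    show Disjoint (⋃ m : Fin M₀, W (g, m)) (⋃ m : Fin M₀, W (g', m))
    rw [Set.disjoint_iUnion_left]
    intro m
    rw [Set.disjoint_iUnion_right]
    intro m'
    exact hWdisj (g, m) (g', m') fun h => hgg' (Prod.ext_iff.1 h).1


/-- **Geometric tail of `N_sf` in blocks of `M₀` (every `p`, every `n ≥ 1`).** On the torus
`T_n`, `P_p(N_sf ≥ k·M₀) ≤ P_p(E □^{M₀})^k` where `E = {some open cluster is slice-filling}` and
`E □^{M₀} = disjointOccurrencePow E M₀`: the inclusion `setOf_mul_le_numSliceFilling_subset` and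
the iterated van den Berg–Kesten inequality `measureReal_disjointOccurrencePow_le` for the local
increasing event `E □^{M₀}` (Grimmett 1999 Thm 2.12 / (2.14)). [folklore] -/
theorem real_mul_le_numSliceFilling_le_pow (p : unitInterval) (n : ℕ) (hn : 1 ≤ n) (M₀ k : ℕ) :
    (bondPercolation (torusGraph 3 n) p).real {ω | k * M₀ ≤ Set.ncard {S : Set (TorusSite 3 n) |
        (∃ x, S = openCluster ω x) ∧ ∃ i : Fin 3, ∀ t : ZMod n, ∃ y ∈ S, y i = t}} ≤
      ((bondPercolation (torusGraph 3 n) p).real (disjointOccurrencePow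
        {ω : BondConfig (TorusSite 3 n) | ∃ x : TorusSite 3 n, ∃ i : Fin 3, ∀ t : ZMod n,
          ∃ y ∈ openCluster ω x, y i = t} M₀)) ^ k := by
  haveI : NeZero n := ⟨by omega⟩
  calc (bondPercolation (torusGraph 3 n) p).real {ω | k * M₀ ≤ Set.ncard {S : Set (TorusSite 3 n) |
          (∃ x, S = openCluster ω x) ∧ ∃ i : Fin 3, ∀ t : ZMod n, ∃ y ∈ S, y i = t}}
      ≤ (bondPercolation (torusGraph 3 n) p).real (disjointOccurrencePow (disjointOccurrencePow
          {ω : BondConfig (TorusSite 3 n) | ∃ x : TorusSite 3 n, ∃ i : Fin 3, ∀ t : ZMod n,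
            ∃ y ∈ openCluster ω x, y i = t} M₀) k) :=
        measureReal_mono (setOf_mul_le_numSliceFilling_subset n M₀ k)
    _ ≤ ((bondPercolation (torusGraph 3 n) p).real (disjointOccurrencePow
          {ω : BondConfig (TorusSite 3 n) | ∃ x : TorusSite 3 n, ∃ i : Fin 3, ∀ t : ZMod n,
            ∃ y ∈ openCluster ω x, y i = t} M₀)) ^ k :=
        measureReal_disjointOccurrencePow_le (torusGraph 3 n) p (isLocalEvent_of_torus n _) k

/-- **BK reduction of the crux `TorusNonProliferation` at block length `M₀` (the weakest BK-type
sufficient input).** Suppose that for SOME `M₀` the critical 3-torus carries `M₀` edge-disjoint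
slice-filling open structures only with probability bounded away from one, eventually in `n`:
`∃ M₀, ∃ c > 0, ∃ N, ∀ n ≥ N, P_{T_n,p_c}((E □^{M₀})ᶜ) ≥ c` (NOT proved; for `M₀ = 1` it is the
torus form of "critical crossing probabilities stay bounded away from one", open in `d = 3`,
false for `d ≥ 7`). Then the number of slice-filling clusters is tight: for `n ≥ N`,
`P(N_sf ≥ k·M₀) ≤ (1 - c)^k` by `real_mul_le_numSliceFilling_le_pow`, and tori `3 ≤ n < N` carry
at most `n³ < N³` slice-filling clusters (landed `ncard_sliceFilling_le`). [folklore] -/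
theorem torusNonProliferation_of_sfWitnesses_eventually_bounded :
    (∃ M₀ : ℕ, ∃ c : ℝ, 0 < c ∧ ∃ N : ℕ, ∀ n : ℕ, N ≤ n →
      c ≤ (Literature.Probability.Percolation.bondPercolation
        (Literature.Probability.LatticeModels.torusGraph 3 n)
        (Literature.Probability.Percolation.criticalProbI 3)).real
        (Literature.Probability.Percolation.disjointOccurrencePow
          {ω : Literature.Probability.Percolation.BondConfig
              (Literature.Probability.LatticeModels.TorusSite 3 n) |
            ∃ x : Literature.Probability.LatticeModels.TorusSite 3 n, ∃ i : Fin 3, ∀ t : ZMod n,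
              ∃ y ∈ Literature.Probability.Percolation.openCluster ω x, y i = t} M₀)ᶜ) →
    Summit.CriticalPhenomena.PercolationContinuityZ3.Theses.PercTorusSliceFilling.TorusNonProliferation := by
  classical
  rintro ⟨M₀, c, hc, N, hN⟩
  unfold Summit.CriticalPhenomena.PercolationContinuityZ3.Theses.PercTorusSliceFilling.TorusNonProliferation
  intro δ hδ
  -- `c ≤ 1`: it is bounded by a probability (use `n = N`)
  have hc1 : c ≤ 1 := (hN N le_rfl).trans measureReal_le_one
  obtain ⟨k, hk⟩ := exists_pow_lt_of_lt_one hδ (show 1 - c < 1 by linarith)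
  -- the level: `M := k·M₀ + N³` dominates both regimes
  refine ⟨k * M₀ + N ^ 3, fun n hn => ?_⟩
  haveI : NeZero n := ⟨by omega⟩
  set μ := bondPercolation (torusGraph 3 n) (criticalProbI 3) with hμ
  by_cases hnN : N ≤ n
  · -- large tori: BK at block length `M₀`
    set F : Set (BondConfig (TorusSite 3 n)) := disjointOccurrencePow
        {ω : BondConfig (TorusSite 3 n) | ∃ x : TorusSite 3 n, ∃ i : Fin 3, ∀ t : ZMod n,
          ∃ y ∈ openCluster ω x, y i = t} M₀ with hFdef
    have hF : μ.real F ≤ 1 - c := by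
      have hmeas : MeasurableSet F := (Set.toFinite _).measurableSet
      have hcompl : μ.real F + μ.real Fᶜ = 1 := probReal_add_probReal_compl hmeas
      have hc' : c ≤ μ.real Fᶜ := hN n hnN
      linarith
    calc μ.real {ω | k * M₀ + N ^ 3 ≤ Set.ncard {S : Set (TorusSite 3 n) |
            (∃ x, S = openCluster ω x) ∧ ∃ i : Fin 3, ∀ t : ZMod n, ∃ y ∈ S, y i = t}}
        ≤ μ.real {ω | k * M₀ ≤ Set.ncard {S : Set (TorusSite 3 n) |
            (∃ x, S = openCluster ω x) ∧ ∃ i : Fin 3, ∀ t : ZMod n, ∃ y ∈ S, y i = t}} := by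
          refine measureReal_mono fun ω hω => ?_
          exact le_trans (Nat.le_add_right _ _) hω
      _ ≤ (μ.real F) ^ k := real_mul_le_numSliceFilling_le_pow (criticalProbI 3) n (by omega) M₀ k
      _ ≤ (1 - c) ^ k := pow_le_pow_left₀ measureReal_nonneg hF k
      _ ≤ δ := hk.le
  · -- small tori `3 ≤ n < N`: at most `n³ < N³` slice-filling clusters, the event is empty
    have hlt : n < N := Nat.lt_of_not_le hnN
    have hsub0 : {ω : BondConfig (TorusSite 3 n) | k * M₀ + N ^ 3 ≤ Set.ncard {S : Set (TorusSite 3 n) |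
        (∃ x, S = openCluster ω x) ∧ ∃ i : Fin 3, ∀ t : ZMod n, ∃ y ∈ S, y i = t}} ⊆ ∅ := by
      intro ω hω
      have h1 := PercTorusSliceFillingThinClusterTransport.ncard_sliceFilling_le n ω
      have h2 : n ^ 3 < N ^ 3 := Nat.pow_lt_pow_left hlt three_ne_zero
      have h3 : k * M₀ + N ^ 3 ≤ n ^ 3 := le_trans hω h1
      omega
    calc μ.real {ω | k * M₀ + N ^ 3 ≤ Set.ncard {S : Set (TorusSite 3 n) |
            (∃ x, S = openCluster ω x) ∧ ∃ i : Fin 3, ∀ t : ZMod n, ∃ y ∈ S, y i = t}}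
        ≤ μ.real (∅ : Set _) := measureReal_mono hsub0
      _ = 0 := measureReal_empty
      _ ≤ δ := hδ.le


end BlockBK

/-! ## The BK branch (lead c2, reshaped by lead c4): stub 4 alone implies the crux BY NAME -/

/-- **`TorusNonProliferation` from stub 4 alone** (hypothesis = `Stubs.stub_sfWitnessesBounded` by
name; conclusion = the route decl by name): the landed block BK reduction
`Theorems.torusNonProliferation_of_sfWitnesses_eventually_bounded` (geometric tail of `N_sf` in
blocks of `M₀`, from the van den Berg–Kesten inequality applied to the unions of the disjoint
open-edge witnesses carried by blocks of `M₀` distinct sf clusters). -/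
theorem TorusNonProliferation_of_bk (h4 : Stubs.stub_sfWitnessesBounded) :
    Summit.CriticalPhenomena.PercolationContinuityZ3.Theses.PercTorusSliceFilling.TorusNonProliferation :=
  -- landed as `Summit.CriticalPhenomena.PercolationContinuityZ3.Theorems.torusNonProliferation_of_sfWitnesses_eventually_bounded`
  -- (p172230); inline copy used until the farm builds that module (see `BlockBK` above)
  BlockBK.torusNonProliferation_of_sfWitnesses_eventually_bounded h4

/-- **Second closing of the skeleton (BK branch)**: the crux from the single open stub
`stub_sfWitnessesBounded`; sorry-free as soon as that stub is discharged. -/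
theorem TorusNonProliferation_proof_bk :
    Summit.CriticalPhenomena.PercolationContinuityZ3.Theses.PercTorusSliceFilling.TorusNonProliferation :=
  TorusNonProliferation_of_bk stub_sfWitnessesBounded

/-- The former BK stub of lead c2 (`M₀ = 1`, uniform in `n ≥ 3`: "no slice-filling cluster with
probability `≥ c`") implies the registered block form `stub_sfWitnessesBounded` (take `M₀ = 1`,
`N = 3`; `E □^1 ⊆ E`). Kept to document that the reshape WEAKENED the stub. -/
theorem stub_sfWitnessesBounded_of_noSliceFillingPos
    (h : ∃ c : ℝ, 0 < c ∧ ∀ n : ℕ, 3 ≤ n →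
      c ≤ (bondPercolation (torusGraph 3 n) (criticalProbI 3)).real
        {ω | ∀ x : TorusSite 3 n, ¬ ∃ i : Fin 3, ∀ t : ZMod n, ∃ y ∈ openCluster ω x, y i = t}) :
    Stubs.stub_sfWitnessesBounded := by
  obtain ⟨c, hc, hcn⟩ := h
  refine ⟨1, c, hc, 3, fun n hn => (hcn n hn).trans (measureReal_mono ?_)⟩
  intro ω hω hmem
  obtain ⟨x, hx⟩ := disjointOccurrencePow_succ_subset _ 0 hmem
  exact hω x hx

/-! ## The X_B branch (lead c3): the existing crux `CritAnnulusNonCrossing` implies the crux -/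

/-- **`TorusNonProliferation` from X_B** (hypothesis = the route item
`PercAnnulusCrossing.CritAnnulusNonCrossing`, stmt-CriticalPhenomena-0846, by name; conclusion =
the route decl by name; no `sorry` in this file's cone): the landed bridge
`Theorems.torusNonProliferation_of_critAnnulusNonCrossing` (27-box cover of the torus, chart
transfer of the annulus crossing, Harris–FKG, BK geometric tail). -/
theorem TorusNonProliferation_of_xb
    (hXB : Summit.CriticalPhenomena.PercolationContinuityZ3.Theses.PercAnnulusCrossing.CritAnnulusNonCrossing) :
    Summit.CriticalPhenomena.PercolationContinuityZ3.Theses.PercTorusSliceFilling.TorusNonProliferation :=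
  Summit.CriticalPhenomena.PercolationContinuityZ3.Theorems.torusNonProliferation_of_critAnnulusNonCrossing hXB

end Summit.CriticalPhenomena.PercolationContinuityZ3.Cruxes.TorusNonProliferation.Birth

end
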